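import Summits.Langlands.Langlands.Theses.CompatibleFamilySplit
import HarnessLib

/-!
# Birth skeleton (BC3) for the crux `CompatibilityAwayFromL` (L∤; item stmt-Langlands-17417) of route
`CompatibleFamilySplit` — published as `Cruxes/CompatibilityAwayFromL/Lines/birth.lean`
(skeleton registrar `planner-skel-stmt-Langlands-17417-0`, 2026-08-17; route re-audit bin HONEST).

**The crux** (route decl `Summit.Langlands.Langlands.Theses.CompatibleFamilySplit.CompatibilityAwayFromL`):
Taylor 2004 Conj. 7 at the finite places `v ∤ ℓ`, `∃ Rec` form — for every number field `K` ONE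
reciprocity datum `Rec` such that every irreducible, pinned-geometric `ρ : Γ_K → GL_n(ℚ̄_ℓ)` that is
Satake–Frobenius compatible a.e. with an L-algebraic cuspidal `π` satisfies the summit's
`LocalGlobalCompatibleAt Rec ι π ρ v` (`ι WD(ρ|_{W_{K_v}})^{F-ss} ≅ rec_v(π_v)`) at every `v ∤ ℓ`.

**The split = the Harris–Taylor / Taylor–Yoshida seam** (the actual history of the theorem in the
polarizable sector; two different techniques):

* `stub_semisimpleCompatibilityAway` — COMPATIBILITY UP TO SEMISIMPLIFICATION, the monodromy
  forgotten on both sides: `[(ι WD(ρ|_{W_{K_v}}))^{F-ss}, N ↦ 0] = [rec_v(π_v), N ↦ 0]` as classes of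
  Frobenius-semisimple Weil–Deligne representations.  This is what the trace-formula comparison of
  the cohomology of Shimura varieties / Igusa varieties gives (Harris–Taylor 2001 Thm VII.1.9 (1),
  p. 195 of the book = PDF p. 209: `[R_l(Π)|_{W_{F_y}}] = [r_l(ι⁻¹ Π_y)]` in the Grothendieck group;
  p. 5 ibid.: "we settle this question affirmatively up to semisimplification. (We do not identify
  the two N's.)"); known for conjugate-self-dual regular algebraic `π` over CM fields
  (HarrisTaylorAMS2001, ChenevierHarris2013) and for regular algebraic `π` over CM fields without
  polarizability (HarrisLanTaylorThorneRMS2016, Scholze2015, VarmaFMS2024); OPEN for irregular `π`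
  and for `K` neither CM nor totally real.
* `stub_monodromyOfSemisimple` — THE TWO `N` AGREE: semisimplified compatibility at `v ∤ ℓ`
  upgrades to Frobenius-semisimple compatibility.  Technique: purity (weight–monodromy) of
  `WD(ρ|_v)` + temperedness of the generic unitary `π_v` + the rigidity lemma TaylorYoshida2007
  Lemma 1.4 (bullets 3–4, arXiv:math/0412357 p. 5–6: "`rec(π)` is pure of some weight iff all `σπ`
  are tempered"; "given `(V, r)` with `r` semisimple there is, up to equivalence, at most one `N`
  which makes `(V, r, N)` pure").  Known: TaylorYoshida2007 (HT-type), Caraiani2012 (all RACSDC,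
  `ℓ ≠ p`); OPEN in the non-polarizable regular case (Varma: only `N_Galois ≼ N_aut`), for irregular
  `π` and general `K`.
* `CompatibilityAwayFromL_of` — the composition (the datum of stub A is the crux's witness `Rec`;
  stub B is datum-uniform), kernel-checked, no `sorry`.

Helper notions (this file, sorry-free, over accepted declarations only): `forgetN r = (r.ρ, 0)`
(accepted `WeilDeligneRep.ofRep`); `classForgetN`, its descent to the accepted quotient
`Quotient (frobSemisimpleWDSetoid F n)` (the target of `rec_n`); `SemisimpleLGCAt` = the summit's
`LocalGlobalCompatibleAt` with the class equation read after `classForgetN` (the vacuous `v ∣ ℓ`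
clause dropped — both stubs live at `v ∤ ℓ`).

Disproof used: none exists for this crux (`ledger crux ls stmt-Langlands-17417`: no `Disproof.lean`,
no Negative lemmas; negatives index of the summit untouched by either stub).  Dead lines: none
recorded on this crux.  The earlier (pre-workfile) birth evidence of route PrimeSwitchSplit split by
PLACE (good places / bad places by excluded middle); this skeleton splits by STRUCTURE of the
Weil–Deligne representation instead, so that neither stub is "the crux minus a landed lemma".
-/

noncomputable section

set_option linter.dupNamespace false

namespace Summit.Langlands.Langlands.Cruxes.CompatibilityAwayFromL.Birth

open scoped MatrixGroups Matrix Classical NumberField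
open NumberField IsDedekindDomain Filter
open Literature.NumberTheory.Automorphic Literature.NumberTheory.GaloisRepresentations
open Summit.Langlands

/-! ### Forgetting the monodromy operator -/

section ForgetN

variable {F : Type*} [Field F] [ValuativeRel F] [TopologicalSpace F] [IsNonarchimedeanLocalField F]
  {C : Type*} [Field C] [CharZero C] {V : Type*} [AddCommGroup V] [Module C V]

/-- `forgetN (ρ, N) = (ρ, 0)`: the Weil–Deligne representation with the same Weil-group action and
trivial monodromy (accepted `WeilDeligneRep.ofRep`). [cite: TateCorvallis1979, (4.1.3)] -/
def forgetN (r : WeilDeligneRep F C V) : WeilDeligneRep F C V :=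
  WeilDeligneRep.ofRep r.ρ r.isContinuous

/-- The Weil-group action of `forgetN r` is that of `r`. [folklore] -/
@[simp] theorem forgetN_ρ (r : WeilDeligneRep F C V) : (forgetN r).ρ = r.ρ := rfl

/-- The monodromy of `forgetN r` is `0`. [folklore] -/
@[simp] theorem forgetN_N (r : WeilDeligneRep F C V) : (forgetN r).N = 0 := rfl

/-- Forgetting `N` preserves Frobenius-semisimplicity (a condition on `ρ` alone). [folklore] -/
theorem forgetN_isFrobSemisimple {r : WeilDeligneRep F C V} (h : r.IsFrobSemisimple) :
    (forgetN r).IsFrobSemisimple :=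
  fun w => h w

/-- Forgetting `N` is functorial on isomorphisms. [folklore] -/
theorem forgetN_isEquivalent {V' : Type*} [AddCommGroup V'] [Module C V']
    {r : WeilDeligneRep F C V} {r' : WeilDeligneRep F C V'} (h : r.IsEquivalent r') :
    (forgetN r).IsEquivalent (forgetN r') := by
  obtain ⟨e⟩ := h
  exact ⟨⟨e.toRepEquiv, by simp⟩⟩

/-- `classForgetN [r] = [(r.ρ, 0)]` on isomorphism classes of Frobenius-semisimple `n`-dimensional
complex Weil–Deligne representations (the target `Quotient (frobSemisimpleWDSetoid F n)` of `rec_n`).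
Two classes with the same image have isomorphic (semisimple) Weil-group representations and
possibly different monodromy: "equality up to semisimplification". [cite: TaylorYoshida2007, §1] -/
def classForgetN {n : ℕ} :
    Quotient (frobSemisimpleWDSetoid F n) → Quotient (frobSemisimpleWDSetoid F n) :=
  Quotient.lift
    (fun r => Quotient.mk (frobSemisimpleWDSetoid F n) ⟨forgetN r.1, forgetN_isFrobSemisimple r.2⟩)
    (fun _ _ hab => Quotient.sound (forgetN_isEquivalent hab))

/-- `classForgetN` on a representative. [folklore] -/
theorem classForgetN_mk {n : ℕ} (r : WeilDeligneRep F ℂ (Fin n → ℂ)) (hr : r.IsFrobSemisimple) :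
    classForgetN (Quotient.mk (frobSemisimpleWDSetoid F n) ⟨r, hr⟩) =
      Quotient.mk (frobSemisimpleWDSetoid F n) ⟨forgetN r, forgetN_isFrobSemisimple hr⟩ := rfl

end ForgetN

/-! ### Local–global compatibility up to semisimplification -/

section Semisimple

variable {n : ℕ} {K : Type} [Field K] [NumberField K] {hcpt : isCompact_glFiniteIntegralLevel n K}
  {ℓ : ℕ} [Fact ℓ.Prime]

/-- **Local–global compatibility at `v` up to semisimplification** (`v ∤ ℓ` intended): there are the
local component `π_v` of `π` at `v` (`HasLocalComponentAt`), a Weil–Deligne representation `r`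
over `ℚ̄_ℓ` which IS `WD(ρ|_{W_{K_v}})` by the Grothendieck–Deligne recipe (`IsWeilDeligneOfLadic`),
its transport `rℂ = ι(r)` and the class `c` of `rℂ^{F-ss}`, such that `c` and `rec_v(π_v)` agree
AFTER FORGETTING THE MONODROMY: `[r^{F-ss}.ρ, 0] = [rec_v(π_v).ρ, 0]` — Harris–Taylor's
"`[R_l(Π)|_{W_{F_y}}] = [r_l(ι⁻¹Π_y)]`, we do not identify the two N's".  Same conjunctive-`∃`
shape as the summit's `LocalGlobalCompatibleAt` (fail-safe), minus its `v ∣ ℓ` clause.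
[cite: HarrisTaylorAMS2001, Thm. VII.1.9] [cite: TaylorYoshida2007, §1] -/
def SemisimpleLGCAt (𝓡 : ReciprocityData K) (ι : PadicAlgCl ℓ ≃+* ℂ)
    (π : AutomorphicRepData (AutomorphyDatum.gl n K hcpt)) (ρ : FramedGaloisRep K (PadicAlgCl ℓ) n)
    (v : HeightOneSpectrum (𝓞 K)) : Prop :=
  ∃ (πv : SmoothIrrep (GL (Fin n) (v.adicCompletion K)))
    (r : WeilDeligneRep (v.adicCompletion K) (PadicAlgCl ℓ) (Fin n → PadicAlgCl ℓ))
    (rℂ : WeilDeligneRep (v.adicCompletion K) ℂ (Fin n → ℂ))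
    (c : Quotient (frobSemisimpleWDSetoid (v.adicCompletion K) n)),
    π.HasLocalComponentAt v πv.ρ ∧
    IsWeilDeligneOfLadic (ρ.toLocal v).toWeilGroupHom r ∧
    r.IsTransportAlong (ι : PadicAlgCl ℓ →+* ℂ) rℂ ∧
    rℂ.HasFrobSemisimpleClass c ∧
    classForgetN c = classForgetN ((𝓡.llc v).recGL n (IrrClass.mk πv))

end Semisimple

/-! ### The two stubs -/

/-- **stub A — SEMISIMPLE LOCAL–GLOBAL COMPATIBILITY AWAY FROM `ℓ`** (`∃ Rec`, the crux's shape):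
for every number field `K` one reciprocity datum `Rec` such that for every L-algebraic cuspidal `π`
of `GL_n(𝔸_K)`, every `(ℓ, ι)` and every irreducible, pinned-geometric `ρ` Satake–Frobenius
compatible with `(π, ι)` a.e., at every `v ∤ ℓ` the Weil-group representations `ι WD(ρ|_{W_{K_v}})^{ss}`
and `rec_v(π_v)|_{W_{K_v}}^{ss}` agree (`SemisimpleLGCAt`).  Why plausibly true: it is the
semisimplified half of Taylor's Conj. 7 — proved by the trace-formula comparison for the cohomology
in which `ρ` is realised whenever such a realisation exists (Harris–Taylor 2001 Thm VII.1.9 (1);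
Chenevier–Harris 2013; non-polarizable regular over CM: HLTT 2016 / Scholze 2015 / Varma 2024), and
it transfers to every irreducible avatar by Chebotarev + Brauer–Nesbitt.  Open core: irregular `π`
(no realisation of `ρ`), `K` neither CM nor totally real.  Size: open-problem (XL in the known
sectors).  Leans on: `ReciprocityData`, `SmoothIrrep`, `IsWeilDeligneOfLadic`, `IsTransportAlong`,
`HasFrobSemisimpleClass`, `LocalLanglandsDatum.recGL` (accepted).
[cite: HarrisTaylorAMS2001, Thm. VII.1.9] [cite: ChenevierHarris2013] [cite: VarmaFMS2024] -/
theorem stub_semisimpleCompatibilityAway : ∀ (K : Type) [Field K] [NumberField K], ∃ Rec : ReciprocityData K, ∀ (n : ℕ) (hcpt : Literature.NumberTheory.Automorphic.isCompact_glFiniteIntegralLevel n K), 0 < n → ∀ (π : Literature.NumberTheory.Automorphic.CuspidalAutomorphicRepData n K hcpt), π.1.IsLAlgebraic → ∀ (ℓ : ℕ) [Fact ℓ.Prime] (ι : PadicAlgCl ℓ ≃+* ℂ) (ρ : Literature.NumberTheory.GaloisRepresentations.FramedGaloisRep K (PadicAlgCl ℓ) n), ρ.toGaloisRep.IsIrreducible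 → ((∀ᶠ v : IsDedekindDomain.HeightOneSpectrum (NumberField.RingOfIntegers K) in cofinite, ρ.IsUnramifiedAt v) ∧ ∀ (v : IsDedekindDomain.HeightOneSpectrum (NumberField.RingOfIntegers K)) (hv : ((ℓ : ℕ) : NumberField.RingOfIntegers K) ∈ v.asIdeal), (Literature.NumberTheory.PAdicHodge.fontainePstAdicCompletion v ℓ hv).IsDeRhamFramed (ρ.toLocal v)) → (∀ᶠ v : IsDedekindDomain.HeightOneSpectrum (NumberField.RingOfIntegers K) in cofinite, SatakeFrobCompatibleAt ι π.1 ρ v) → ∀ v : IsDedekindDomain.HeightOneSpectrum (NumberField.RingOfIntegers K), ((ℓ : ℕ) : NumberField.RingOfIntegers K) ∉ v.asIdeal → SemisimpleLGCAt Rec ι π.1 ρ v := by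
  sorry

/-- **stub B — THE MONODROMY OPERATORS AGREE** (datum-uniform, `∀ Rec`): for every reciprocity
datum `Rec`, every L-algebraic cuspidal `π`, `(ℓ, ι)`, every irreducible pinned-geometric `ρ`
Satake–Frobenius compatible with `(π, ι)` a.e. and every `v ∤ ℓ`, semisimplified compatibility at
`v` (`SemisimpleLGCAt`) implies the summit's Frobenius-semisimple compatibility
`LocalGlobalCompatibleAt Rec ι π ρ v` (`ι WD(ρ|_{W_{K_v}})^{F-ss} ≅ rec_v(π_v)`, `N` included).  Why
plausibly true: Taylor–Yoshida's mechanism — `WD(ρ|_v)` is pure of some weight (weight–monodromy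
for the realisation of `ρ`; Rapoport–Zink spectral sequence in TY, Caraiani 2012 in general for
Shimura varieties), `π_v` is generic unitary and — granted temperedness — `rec_v(π_v)` is pure
(TY Lemma 1.4 (3)), and a semisimple Weil representation carries at most one `N` making it pure
(TY Lemma 1.4 (4)); so the two Frobenius-semisimple classes with equal `classForgetN` coincide.
Open core: purity of `WD(ρ|_v)` off the Shimura-variety sector (non-polarizable regular: Varma
2024 obtains only `N_Galois ≼ N_aut`; irregular `π`; general `K`) and temperedness of `π_v`.
Size: open-problem (L–XL in the RACSDC sector given the facts).  Leans on: `LocalGlobalCompatibleAt`,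
`SemisimpleLGCAt`, TY Lemma 1.4 (not in tree: a Literature fact to vendor), `IsLocalLanglandsGL`.
[cite: TaylorYoshida2007, Lemma 1.4 and Thm. 1.2] [cite: Caraiani2012, Thm. 1.1] [cite: VarmaFMS2024] -/
theorem stub_monodromyOfSemisimple : ∀ (K : Type) [Field K] [NumberField K] (Rec : ReciprocityData K) (n : ℕ) (hcpt : Literature.NumberTheory.Automorphic.isCompact_glFiniteIntegralLevel n K), 0 < n → ∀ (π : Literature.NumberTheory.Automorphic.CuspidalAutomorphicRepData n K hcpt), π.1.IsLAlgebraic → ∀ (ℓ : ℕ) [Fact ℓ.Prime] (ι : PadicAlgCl ℓ ≃+* ℂ) (ρ : Literature.NumberTheory.GaloisRepresentations.FramedGaloisRep K (PadicAlgCl ℓ) n), ρ.toGaloisRep.IsIrreducible → ((∀ᶠ v : IsDedekindDomain.HeightOneSpectrum (NumberField.RingOfIntegers K) in cofinite, ρ.IsUnramifiedAt v) ∧ ∀ (v : IsDedekindDomain.HeightOneSpectrum (NumberField.RingOfIntegers K)) (hv : ((ℓ : ℕ) : NumberField.RingOfIntegers K) ∈ v.asIdeal), (Literature.NumberTheory.PAdicHodge.fontainePstAdicCompletion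 v ℓ hv).IsDeRhamFramed (ρ.toLocal v)) → (∀ᶠ v : IsDedekindDomain.HeightOneSpectrum (NumberField.RingOfIntegers K) in cofinite, SatakeFrobCompatibleAt ι π.1 ρ v) → ∀ v : IsDedekindDomain.HeightOneSpectrum (NumberField.RingOfIntegers K), ((ℓ : ℕ) : NumberField.RingOfIntegers K) ∉ v.asIdeal → SemisimpleLGCAt Rec ι π.1 ρ v → LocalGlobalCompatibleAt Rec ι π.1 ρ v := by
  sorry

/-! ### The stub statements as named propositions (the composition's hypotheses, by name)

`_Goal` is internal on purpose: audits listing the file's declarations by short name find the `stub_*`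
THEOREMS, while the skeleton check accepts the hypotheses of `CompatibilityAwayFromL_of` by the stub
names they carry.  Each `_Goal.stub_x` is `type_of% @stub_x` — no text duplicated, no `sorry` inherited. -/

namespace _Goal

/-- The statement of `stub_semisimpleCompatibilityAway`, as a named `Prop` (literally its type). [folklore] -/
def stub_semisimpleCompatibilityAway : Prop :=
  type_of% @Summit.Langlands.Langlands.Cruxes.CompatibilityAwayFromL.Birth.stub_semisimpleCompatibilityAway

/-- The statement of `stub_monodromyOfSemisimple`, as a named `Prop` (literally its type). [folklore] -/
def stub_monodromyOfSemisimple : Prop :=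
  type_of% @Summit.Langlands.Langlands.Cruxes.CompatibilityAwayFromL.Birth.stub_monodromyOfSemisimple

end _Goal

/-! ### The composition (kernel-checked, no `sorry`; concludes the route decl BY NAME) -/

/-- **L∤ from its two stubs.**  Fix `K`; take the datum `Rec` of stub A; under the crux's binders,
stub A gives semisimplified compatibility at `v ∤ ℓ` for `Rec` and stub B (at that `Rec`) upgrades it
to `LocalGlobalCompatibleAt Rec ι π ρ v`.  The hypotheses are, by name, the statements of
`stub_semisimpleCompatibilityAway` and `stub_monodromyOfSemisimple`; the conclusion is the route decl
`Summit.Langlands.Langlands.Theses.CompatibleFamilySplit.CompatibilityAwayFromL`.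
[cite: TaylorYoshida2007, Thm. 1.2] -/
theorem CompatibilityAwayFromL_of (hA : _Goal.stub_semisimpleCompatibilityAway)
    (hB : _Goal.stub_monodromyOfSemisimple) :
    Summit.Langlands.Langlands.Theses.CompatibleFamilySplit.CompatibilityAwayFromL := by
  unfold _Goal.stub_semisimpleCompatibilityAway at hA
  unfold _Goal.stub_monodromyOfSemisimple at hB
  intro K _ _
  obtain ⟨Rec, h⟩ := hA K
  refine ⟨Rec, ?_⟩
  intro n hcpt hn π hL ℓ _ ι ρ hirr hgeo hsat v hv
  exact hB K Rec n hcpt hn π hL ℓ ι ρ hirr hgeo hsat v hv (h n hcpt hn π hL ℓ ι ρ hirr hgeo hsat v hv)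

/-- By-name sanity check: the stubs' own types feed `CompatibilityAwayFromL_of` and the conclusion
is literally the route decl. -/
example : Summit.Langlands.Langlands.Theses.CompatibleFamilySplit.CompatibilityAwayFromL :=
  CompatibilityAwayFromL_of stub_semisimpleCompatibilityAway stub_monodromyOfSemisimple

end Summit.Langlands.Langlands.Cruxes.CompatibilityAwayFromL.Birth

end
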